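import Summits.ResolutionOfSingularities.ResolutionOfSingularities.Theorems.EquisingularLiftEquisingularLiftNatResidueHypDefsE4
import Mathlib.Algebra.MvPolynomial.PDeriv
import HarnessLib

/-!
# [OURS · L1 W4.5(b) · EL♮ / EL♮(3)] RESIDUE HYPOTHESIS DEFS E5 — WIDTH TABLE D11 door ν3ᶜⁱ «ci-DIRECT NOSE»: `ReachDirectCINose₂` and the blob
# `NoseHypHostedNestEquinodalDirectCIBTriplePrime₂` (= …DefsE4's 46th blob with a THIRD disjunct in the initial-stage nose rule)

Typed by res-type-027 g23 on the desk's RULING R72a (2026-08-29T07:06:55Z; D11 «Σ5a ci-DIRECT» DEALT on the panel-certified customer S♯_ν(G₇) = V(h² + A q²) ⊂ ℙ³/𝔽̄₇,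
nose `Z′ = V₊(q, h)`, lead-1 `SHARP7-CERTIFICATE.md` 70f4d67028538f11; letters and placement = idea-2 g30 `D11-CI-DIRECT-SIZING.md` cd5c664317da9e7f §1–§2; module name:
`…DefsE5` is free at filing — the unfiled D10 Σ4 draft moves to E6).  WHAT.  (a″) `ReachDirectCINose₂ k n T₁ F₉ β T₉ E₉` — NO host, NO `ℓ`: the ν3ᵈ door with the
host clauses and the idle conjuncts (`IsPreirreducible Z`, ambient-regular) deleted, the equation block replaced by the ci block
`∃ d₁ d₂ f₁ f₂, f₁.IsHomogeneous d₁ ∧ f₂.IsHomogeneous d₂ ∧ Z = V₊(f₁) ∩ V₊(f₂) ∧ IsRelPrime f₁ f₂ ∧ f₂ ≠ 0 ∧ (Ideal.span {f₁, f₂}).IsRadical ∧ (HOST-J)`,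
(HOST-J) = `∀ y ∈ Z, ∃ i, pderiv i f₁ ∉ y`; curve clause (= n-scope guard), (N1), direct round + B‴ tail verbatim.  (b″) the blob = the 46th's blob with the
rule's door `(ν4 ∨ ν3ᵈ) ∨ ν3ᶜⁱ` (old door = left unit ⇒ K5ⁱ unchanged, `HSUBⁱ := hR.elim HSUBᵉᵈ HSUBᶜⁱ`).  (c″) pure logic: `…DirectCI…₂_of_equinodalDirect₂` (`Or.inl`),
`not_noseHypHostedNestEquinodalDirectBTriplePrime₂_of_not_directCI₂` (the 47th's REPLACE lemma) and the chained `not_` lemmas.  The optional census lemma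
«ν3ᵈ ⇒ ν3ᶜⁱ» (idea-2 §5 (β): `f₁ :=` the host's linear normal form) is NOT pure logic (needs ✓ `HyperplaneLift`/`HostNormalForm`) and is left to an idle hand.
HONEST SIZING: after a 47th the nose residue reads «¬((ν4 ∨ ν3ᵈ) ∨ ν3ᶜⁱ)»; Σ2/Σ3 (non-reduced), Σ5b (non-ci), Σ6 (embedding dimension 3 — NO-GO ✓ p703581),
Σ7 stay outside by letters; nothing of EL♮(3) is proved by a wider door.
House style R21″ (C): definitions + pure-logic lemmas; no `sorry`, no instance, no notation; standard axioms.  OURS; NAMED HYPOTHESES, not statements of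
any manuscript; nothing of [Hironaka2017] is asserted; AI-written, weaker than expert review; EL♮(3) NOT proved; resolution in positive characteristic NOT
proved (dim 3 = Cossart–Piltant 2008/2009).  `--kind definition --supports stmt-ResolutionOfSingularities-20148 --as helper`.
-/

set_option linter.dupNamespace false
noncomputable section
open CategoryTheory CategoryTheory.Limits AlgebraicGeometry TopologicalSpace Topology IsLocalRing
open Literature.AlgebraicGeometry.Resolution
open AlgebraicGeometry.Scheme.IdealSheafData
namespace Summit.ResolutionOfSingularities.ResolutionOfSingularities.Cruxes.EquisingularLiftNat.Sections

/-- **`ReachDirectCINose₂ k n T₁ F₉ β T₉ E₉`** — door ν3ᶜⁱ «ci-DIRECT NOSE» (WIDTH TABLE D11, desk R72/R72a on the panel-certified customer S♯_ν(G₇) =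
V(h² + A q²) ⊂ ℙ³/𝔽̄₇, lead-1 `SHARP7-CERTIFICATE.md` 70f4d67028538f11; letters = idea-2 g30 `D11-CI-DIRECT-SIZING.md` cd5c664317da9e7f §1), INITIAL STAGE, NO HOST: the
ν3ᵈ door `ReachDirectPlanarNose₂` (…DefsE4) with the three HOST clauses DELETED («`Z ⊆ V₊(ℓ)`», «host regular along `Z̃`», «host two-dimensional along `Z`»;
hence no `ℓ` argument), the idle conjuncts `IsPreirreducible Z` and «ambient regular along `Z̃`» DELETED ((xxxvii) idle-conjunct sweep: read by no supplier),
the EQUATION block `(e, g, B, r)` REPLACED by the COMPLETE-INTERSECTION block `(d₁ d₂ f₁ f₂)` — `fᵢ` homogeneous of degree `dᵢ`, `Z = V₊(f₁) ∩ V₊(f₂)` as a set,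
`IsRelPrime f₁ f₂`, `f₂ ≠ 0`, `(f₁, f₂)` RADICAL (= ✓ `CIModel.ci_trace_and_flat`'s hypotheses read downstairs) — plus ONE new pointwise letter (HOST-J) «`V₊(f₁)` is
smooth along `Z`»: `∀ y ∈ Z, ∃ i, ∂ᵢ f₁ ∉ y` (so every point of `Z̃` has embedding dimension ≤ 2: the exact complement of the Σ6 NO-GO ✓ p703581);
`E₉ = ∅`, `Z ⊆ T₁ ∧ ¬ T₁ ⊆ Z ∧ Z.Infinite`, the curve clause (which is also the n-SCOPE guard: a ci curve in `ℙⁿ` forces `n = 3`), (N1), the DIRECT round at `Z`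
and the B‴ tail `∀R`-clause VERBATIM.  Upstairs supplier: the ci SMOOTHING `V(f̃₁, f̃₂ + ϖU)` («ci_trace_smoothing», stub-2/nose-w1; TRACE + FLAT = ✓ p704449) +
✓ p702606 `directNose_stage_zero_of_model` (stub-4's (ε″)).  [OURS · named hypothesis fragment, no mathematical content of its own] -/
def ReachDirectCINose₂ (k : Type) [Field k] (n : ℕ)
    (T₁ : Set (Literature.AlgebraicGeometry.Motives.projectiveSpace n k).left) (F₉ : Scheme.{0}) (β : F₉ ⟶ (Literature.AlgebraicGeometry.Motives.projectiveSpace n k).left) (T₉ E₉ : Set F₉) : Prop :=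
  letI := MvPolynomial.gradedAlgebra (σ := Fin (n + 1)) (R := k)
  E₉ = ∅ ∧
  ∃ (Z : Set (Literature.AlgebraicGeometry.Motives.projectiveSpace n k).left) (hZ : IsClosed Z),
    Z ⊆ T₁ ∧ ¬ (T₁ ⊆ Z) ∧ Z.Infinite ∧
    -- curve clause (= the n-SCOPE guard: fires only for n = 3)
    (∀ z : ↥(redSub (Literature.AlgebraicGeometry.Motives.projectiveSpace n k).left Z hZ), IsClosed ({z} : Set ↥(redSub (Literature.AlgebraicGeometry.Motives.projectiveSpace n k).left Z hZ)) →
      ringKrullDim ((redSub (Literature.AlgebraicGeometry.Motives.projectiveSpace n k).left Z hZ).presheaf.stalk z) = ((1 : ℕ) : WithBot ℕ∞)) ∧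
    -- (N1) finitely many non-regular points of the reduced nose `Z̃` (= the supply lemma's binder)
    Set.Finite {z : ↥(redSub (Literature.AlgebraicGeometry.Motives.projectiveSpace n k).left Z hZ) |
      ¬ IsRegularLocalRing ((redSub (Literature.AlgebraicGeometry.Motives.projectiveSpace n k).left Z hZ).presheaf.stalk z)} ∧
    -- the COMPLETE-INTERSECTION block (= ✓ `CIModel.ci_trace_and_flat`'s hypotheses read downstairs) + (HOST-J)
    (∃ (d₁ d₂ : ℕ) (f₁ f₂ : MvPolynomial (Fin (n + 1)) k),
      f₁.IsHomogeneous d₁ ∧ f₂.IsHomogeneous d₂ ∧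
      Z = {y : (Literature.AlgebraicGeometry.Motives.projectiveSpace n k).left | f₁ ∈ (y : ProjectiveSpectrum (MvPolynomial.homogeneousSubmodule (Fin (n + 1)) k)).asHomogeneousIdeal ∧
             f₂ ∈ (y : ProjectiveSpectrum (MvPolynomial.homogeneousSubmodule (Fin (n + 1)) k)).asHomogeneousIdeal} ∧
      IsRelPrime f₁ f₂ ∧ f₂ ≠ 0 ∧ (Ideal.span {f₁, f₂}).IsRadical ∧
      -- (HOST-J): the hypersurface `V₊(f₁)` is smooth at every point of `Z`
      (∀ y ∈ Z, ∃ i : Fin (n + 1), ¬ (MvPolynomial.pderiv i f₁ ∈ (y : ProjectiveSpectrum (MvPolynomial.homogeneousSubmodule (Fin (n + 1)) k)).asHomogeneousIdeal))) ∧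
    -- the DIRECT nose round at `Z` itself, then a B‴ tail (verbatim)
    ∃ (F₃ : Scheme.{0}) (υ' : F₃ ⟶ (Literature.AlgebraicGeometry.Motives.projectiveSpace n k).left),
      IsBlowup υ' (vanishingIdeal (⟨Z, hZ⟩ : Closeds (Literature.AlgebraicGeometry.Motives.projectiveSpace n k).left)) ∧
      ∃ (γ' : F₉ ⟶ F₃) (E' : Set F₉) (Es' Ns' : List (Set F₉)) (K' : Set F₉),
        (∀ R : (∀ G : Scheme.{0}, (G ⟶ F₃) → Set G → Set G → List (Set G) → List (Set G) → Set G → Prop),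
          R F₃ (𝟙 F₃) (closure (υ' ⁻¹' (T₁ \ Z))) (υ' ⁻¹' Z) [] [] ∅ →
          TowerPtRegB₄ F₃ R → TowerPtRamB₄ F₃ R → TowerRoundBTriplePrime (Literature.AlgebraicGeometry.Motives.projectiveSpace n k).left F₃ υ' Z hZ R →
          R F₉ γ' T₉ E' Es' Ns' K') ∧
        β = γ' ≫ υ'

/-- **`NoseHypHostedNestEquinodalDirectCIBTriplePrime₂ k n H ι`** (blob for the 47th, door «(ν4 ∨ ν3ᵈ) ∨ ν3ᶜⁱ») —
`NoseHypHostedNestEquinodalDirectBTriplePrime₂` (…DefsE4, the 46th's blob) VERBATIM except that the initial-stage nose rule's door gains a THIRD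
disjunct: `(ReachEquinodalPlanarNose₂ … ∨ ReachDirectPlanarNose₂ …) ∨ ReachDirectCINose₂ k n (range ι) F₉ β T₉ E₉` — the OLD door is the left unit, so the
engine is ✓ K5ⁱ with `HSUBⁱ := hR.elim HSUBᵉᵈ HSUBᶜⁱ` (zero engine change; the ci disjunct ignores the rule's `ℓ`, the customer names a DUMMY hyperplane host
`E₀ = V₊(ℓ)`, `range ι ⊄ V₊(ℓ)`, dropped by `E₉ = ∅` — idea-2 §2's honest wart).  More closure asked of `Q` ⇒ implied by the 46th's blob (`…_of_equinodalDirect₂`,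
`Or.inl`).  Rung shape (R-ν3ᶜⁱ, stub-4 (ζ″) `nose_ci_rung_three`); the 47th = count-neutral REPLACE
`¬ NoseHypHostedNestEquinodalDirectBTriplePrime₂ ↦ ¬ NoseHypHostedNestEquinodalDirectCIBTriplePrime₂`.  [OURS · L1 W4.5b · named hypothesis, no mathematical content of its own] -/
def NoseHypHostedNestEquinodalDirectCIBTriplePrime₂ (k : Type) [Field k] [IsAlgClosed k] (n : ℕ) (H : AlgebraicGeometry.Scheme.{0})
    (ι : H ⟶ (Literature.AlgebraicGeometry.Motives.projectiveSpace n k).left) : Prop :=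
  letI := MvPolynomial.gradedAlgebra (σ := Fin (n + 1)) (R := k)
  ∃ (E₀ : Set (Literature.AlgebraicGeometry.Motives.projectiveSpace n k).left),
    (E₀ = ∅ ∨ ∃ ℓ : MvPolynomial (Fin (n + 1)) k, ℓ.IsHomogeneous 1 ∧ ℓ ≠ 0 ∧
      ¬ (Set.range ι ⊆ {y : (Literature.AlgebraicGeometry.Motives.projectiveSpace n k).left |
        ℓ ∈ (y : ProjectiveSpectrum (MvPolynomial.homogeneousSubmodule (Fin (n + 1)) k)).asHomogeneousIdeal}) ∧
      E₀ = {y : (Literature.AlgebraicGeometry.Motives.projectiveSpace n k).left |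
        ℓ ∈ (y : ProjectiveSpectrum (MvPolynomial.homogeneousSubmodule (Fin (n + 1)) k)).asHomogeneousIdeal}) ∧
    (∃ (F' : AlgebraicGeometry.Scheme.{0}) (ρ' : F' ⟶ (Literature.AlgebraicGeometry.Motives.projectiveSpace n k).left) (T' : Set F'),
      (∀ Q : (∀ F₁ : AlgebraicGeometry.Scheme.{0}, (F₁ ⟶ (Literature.AlgebraicGeometry.Motives.projectiveSpace n k).left) → Set F₁ → Set F₁ → Prop),
        Q (Literature.AlgebraicGeometry.Motives.projectiveSpace n k).left (𝟙 (Literature.AlgebraicGeometry.Motives.projectiveSpace n k).left) (Set.range ι) E₀ →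
        (∀ (F₁ F₂ : AlgebraicGeometry.Scheme.{0}) (ρ : F₁ ⟶ (Literature.AlgebraicGeometry.Motives.projectiveSpace n k).left) (T₁ E₁ : Set F₁)
            (x : ↥((AlgebraicGeometry.Scheme.IdealSheafData.vanishingIdeal (⟨closure T₁, isClosed_closure⟩ : TopologicalSpace.Closeds F₁))).subscheme) (υ : F₂ ⟶ F₁) (hx : IsClosed ({(((AlgebraicGeometry.Scheme.IdealSheafData.vanishingIdeal (⟨closure T₁, isClosed_closure⟩ : TopologicalSpace.Closeds F₁))).subschemeι x : F₁)} : Set F₁)),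
          Q F₁ ρ T₁ E₁ → ¬ IsRegularLocalRing (((AlgebraicGeometry.Scheme.IdealSheafData.vanishingIdeal (⟨closure T₁, isClosed_closure⟩ : TopologicalSpace.Closeds F₁))).subscheme.presheaf.stalk x) →
          IsRegularLocalRing (F₁.presheaf.stalk (((AlgebraicGeometry.Scheme.IdealSheafData.vanishingIdeal (⟨closure T₁, isClosed_closure⟩ : TopologicalSpace.Closeds F₁))).subschemeι x : F₁)) →
          ((((AlgebraicGeometry.Scheme.IdealSheafData.vanishingIdeal (⟨closure T₁, isClosed_closure⟩ : TopologicalSpace.Closeds F₁))).subschemeι x : F₁) ∈ closure E₁ → ∀ e : ↥(redSub F₁ (closure E₁) isClosed_closure), (redSubι F₁ (closure E₁) isClosed_closure e : F₁) = (((AlgebraicGeometry.Scheme.IdealSheafData.vanishingIdeal (⟨closure T₁, isClosed_closure⟩ : TopologicalSpace.Closeds F₁))).subschemeι x : F₁) →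
          IsRegularLocalRing ((redSub F₁ (closure E₁) isClosed_closure).presheaf.stalk e)) → Literature.AlgebraicGeometry.Resolution.IsBlowup υ
            (AlgebraicGeometry.Scheme.IdealSheafData.vanishingIdeal (⟨{(((AlgebraicGeometry.Scheme.IdealSheafData.vanishingIdeal (⟨closure T₁, isClosed_closure⟩ : TopologicalSpace.Closeds F₁))).subschemeι x : F₁)}, hx⟩ : TopologicalSpace.Closeds F₁)) →
          Q F₂ (υ ≫ ρ) (closure (υ ⁻¹' (T₁ \ {(((AlgebraicGeometry.Scheme.IdealSheafData.vanishingIdeal (⟨closure T₁, isClosed_closure⟩ : TopologicalSpace.Closeds F₁))).subschemeι x : F₁)}))) (closure (υ ⁻¹' (E₁ \ {(((AlgebraicGeometry.Scheme.IdealSheafData.vanishingIdeal (⟨closure T₁, isClosed_closure⟩ : TopologicalSpace.Closeds F₁))).subschemeι x : F₁)})))) →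
        -- STAGE-LEVEL HOSTED ROUND at a regular curve `Z` inside the host, unobstructed IN THE HOST (in-host NEST lines and the nose curve alike)
        (∀ (F₁ F₃ : AlgebraicGeometry.Scheme.{0}) (ρ : F₁ ⟶ (Literature.AlgebraicGeometry.Motives.projectiveSpace n k).left) (T₁ E₁ : Set F₁) (Z : Set F₁) (hZ : IsClosed Z) (υ' : F₃ ⟶ F₁),
          Q F₁ ρ T₁ E₁ → Z ⊆ closure E₁ → Z ⊆ T₁ → ¬ T₁ ⊆ Z → (∀ z : ↥(redSub F₁ Z hZ), IsRegularLocalRing ((redSub F₁ Z hZ).presheaf.stalk z)) →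
          (∀ (i : redSub F₁ Z hZ ⟶ redSub F₁ (closure E₁) isClosed_closure), i ≫ redSubι F₁ (closure E₁) isClosed_closure = redSubι F₁ Z hZ →
            ∀ z : ↥(redSub F₁ Z hZ), IsRegularLocalRing ((redSub F₁ (closure E₁) isClosed_closure).presheaf.stalk (i z))) → DirStepUnobs F₁ (closure E₁) isClosed_closure Z hZ →
          (∀ z : ↥(redSub F₁ Z hZ), IsClosed ({z} : Set ↥(redSub F₁ Z hZ)) → ringKrullDim ((redSub F₁ Z hZ).presheaf.stalk z) = ((1 : ℕ) : WithBot ℕ∞)) →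
          Literature.AlgebraicGeometry.Resolution.IsBlowup υ' (AlgebraicGeometry.Scheme.IdealSheafData.vanishingIdeal (⟨Z, hZ⟩ : TopologicalSpace.Closeds F₁)) →
          Q F₃ (υ' ≫ ρ) (closure (υ' ⁻¹' (T₁ \ Z))) (closure (υ' ⁻¹' (closure E₁ \ Z)))) →
        (∀ (F₁ : AlgebraicGeometry.Scheme.{0}) (ρ : F₁ ⟶ (Literature.AlgebraicGeometry.Motives.projectiveSpace n k).left) (T₁ E₁ : Set F₁) (F₉ : AlgebraicGeometry.Scheme.{0}) (β : F₉ ⟶ F₁) (T₉ E₉ : Set F₉),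
          Q F₁ ρ T₁ E₁ → ReachHostedNoseBTriplePrime F₁ T₁ E₁ F₉ β T₉ E₉ → Q F₉ (β ≫ ρ) T₉ E₉) →
        -- INITIAL-STAGE NOSE, host named as the hyperplane `E₀ = V₊(ℓ)`: door ν4 «EQUINODAL» OR door ν3ᵈ «DIRECT PLANAR» (both inside the host) OR door ν3ᶜⁱ
        -- «ci-DIRECT» (`ReachDirectCINose₂`: host-free — `ℓ` is a dummy —, the nose round at the reduced ci curve `Z = V₊(f₁,f₂)` itself, upstairs centre = an explicit
        -- ci SMOOTHING, then a B‴ tail); unavailable when `E₀ = ∅`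
        (∀ (ℓ : MvPolynomial (Fin (n + 1)) k) (F₉ : AlgebraicGeometry.Scheme.{0}) (β : F₉ ⟶ (Literature.AlgebraicGeometry.Motives.projectiveSpace n k).left) (T₉ E₉ : Set F₉),
          Q (Literature.AlgebraicGeometry.Motives.projectiveSpace n k).left (𝟙 (Literature.AlgebraicGeometry.Motives.projectiveSpace n k).left) (Set.range ι) E₀ →
          E₀ = {y : (Literature.AlgebraicGeometry.Motives.projectiveSpace n k).left |
            ℓ ∈ (y : ProjectiveSpectrum (MvPolynomial.homogeneousSubmodule (Fin (n + 1)) k)).asHomogeneousIdeal} →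
          ((ReachEquinodalPlanarNose₂ k n ℓ (Set.range ι) F₉ β T₉ E₉ ∨ ReachDirectPlanarNose₂ k n ℓ (Set.range ι) F₉ β T₉ E₉) ∨
              ReachDirectCINose₂ k n (Set.range ι) F₉ β T₉ E₉) →
            Q F₉ β T₉ E₉) → ∃ E' : Set F', Q F' ρ' T' E') ∧
      Literature.AlgebraicGeometry.Resolution.Scheme.IsRegular (AlgebraicGeometry.Scheme.IdealSheafData.vanishingIdeal (⟨closure T', isClosed_closure⟩ : TopologicalSpace.Closeds F')).subscheme)


/-- the 46th's blob ⇒ the «(ν4 ∨ ν3ᵈ) ∨ ν3ᶜⁱ» blob (the motive is asked to be closed under MORE moves; `Or.inl`). [OURS · pure logic] -/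
theorem noseHypHostedNestEquinodalDirectCIBTriplePrime₂_of_equinodalDirect₂ (k : Type) [Field k] [IsAlgClosed k] (n : ℕ)
    (H : AlgebraicGeometry.Scheme.{0}) (ι : H ⟶ (Literature.AlgebraicGeometry.Motives.projectiveSpace n k).left)
    (h : NoseHypHostedNestEquinodalDirectBTriplePrime₂ k n H ι) : NoseHypHostedNestEquinodalDirectCIBTriplePrime₂ k n H ι := by
  obtain ⟨E₀, hE₀, F', ρ', T', hQ, hreg⟩ := h
  refine ⟨E₀, hE₀, F', ρ', T', fun Q hQ0 hpt hround hreach hci => hQ Q hQ0 hpt hround hreach ?_, hreg⟩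
  intro ℓ F₉ β T₉ E₉ hQ₀ hE hR
  exact hci ℓ F₉ β T₉ E₉ hQ₀ hE (Or.inl hR)

/-- blob₃ᵉ v2 (`NoseHypHostedNestEquinodalBTriplePrime₂`) ⇒ the «(ν4 ∨ ν3ᵈ) ∨ ν3ᶜⁱ» blob. [OURS · pure logic] -/
theorem noseHypHostedNestEquinodalDirectCIBTriplePrime₂_of_equinodal₂ (k : Type) [Field k] [IsAlgClosed k] (n : ℕ)
    (H : AlgebraicGeometry.Scheme.{0}) (ι : H ⟶ (Literature.AlgebraicGeometry.Motives.projectiveSpace n k).left)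
    (h : NoseHypHostedNestEquinodalBTriplePrime₂ k n H ι) : NoseHypHostedNestEquinodalDirectCIBTriplePrime₂ k n H ι :=
  noseHypHostedNestEquinodalDirectCIBTriplePrime₂_of_equinodalDirect₂ k n H ι
    (noseHypHostedNestEquinodalDirectBTriplePrime₂_of_equinodal₂ k n H ι h)

/-- Contrapositive, as the 47th REPLACE cut consumes it: `¬ ((ν4 ∨ ν3ᵈ) ∨ ν3ᶜⁱ blob) → ¬ (46th blob)`. [OURS · pure logic] -/
theorem not_noseHypHostedNestEquinodalDirectBTriplePrime₂_of_not_directCI₂ (k : Type) [Field k] [IsAlgClosed k] (n : ℕ)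
    (H : AlgebraicGeometry.Scheme.{0}) (ι : H ⟶ (Literature.AlgebraicGeometry.Motives.projectiveSpace n k).left)
    (h : ¬ NoseHypHostedNestEquinodalDirectCIBTriplePrime₂ k n H ι) : ¬ NoseHypHostedNestEquinodalDirectBTriplePrime₂ k n H ι :=
  fun h' => h (noseHypHostedNestEquinodalDirectCIBTriplePrime₂_of_equinodalDirect₂ k n H ι h')

/-- … `¬ ((ν4 ∨ ν3ᵈ) ∨ ν3ᶜⁱ blob) → ¬ blob₃ᵉ v2`. [OURS · pure logic] -/
theorem not_noseHypHostedNestEquinodalBTriplePrime₂_of_not_directCI₂ (k : Type) [Field k] [IsAlgClosed k] (n : ℕ)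
    (H : AlgebraicGeometry.Scheme.{0}) (ι : H ⟶ (Literature.AlgebraicGeometry.Motives.projectiveSpace n k).left)
    (h : ¬ NoseHypHostedNestEquinodalDirectCIBTriplePrime₂ k n H ι) : ¬ NoseHypHostedNestEquinodalBTriplePrime₂ k n H ι :=
  not_noseHypHostedNestEquinodalBTriplePrime₂_of_not_equinodalDirect₂ k n H ι
    (not_noseHypHostedNestEquinodalDirectBTriplePrime₂_of_not_directCI₂ k n H ι h)

/-- … `¬ ((ν4 ∨ ν3ᵈ) ∨ ν3ᶜⁱ blob) → ¬ blob₂`. [OURS · pure logic] -/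
theorem not_noseHypHostedNestBTriplePrime₂_of_not_directCI₂ (k : Type) [Field k] [IsAlgClosed k] (n : ℕ)
    (H : AlgebraicGeometry.Scheme.{0}) (ι : H ⟶ (Literature.AlgebraicGeometry.Motives.projectiveSpace n k).left)
    (h : ¬ NoseHypHostedNestEquinodalDirectCIBTriplePrime₂ k n H ι) : ¬ NoseHypHostedNestBTriplePrime₂ k n H ι :=
  not_noseHypHostedNestBTriplePrime₂_of_not_equinodalDirect₂ k n H ι
    (not_noseHypHostedNestEquinodalDirectBTriplePrime₂_of_not_directCI₂ k n H ι h)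

/-- … `¬ ((ν4 ∨ ν3ᵈ) ∨ ν3ᶜⁱ blob) → ¬ NoseHypPointsFirstBTriplePrime`. [OURS · pure logic] -/
theorem not_noseHypPointsFirstBTriplePrime_of_not_directCI₂ (k : Type) [Field k] [IsAlgClosed k] (n : ℕ)
    (H : AlgebraicGeometry.Scheme.{0}) (ι : H ⟶ (Literature.AlgebraicGeometry.Motives.projectiveSpace n k).left)
    (h : ¬ NoseHypHostedNestEquinodalDirectCIBTriplePrime₂ k n H ι) : ¬ NoseHypPointsFirstBTriplePrime k n H ι :=
  not_noseHypPointsFirstBTriplePrime_of_not_equinodalDirect₂ k n H ι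
    (not_noseHypHostedNestEquinodalDirectBTriplePrime₂_of_not_directCI₂ k n H ι h)

end Summit.ResolutionOfSingularities.ResolutionOfSingularities.Cruxes.EquisingularLiftNat.Sections

end
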